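import Literature.Probability.LatticeModels.RandomClusterFKG
import HarnessLib

/-!
# Continuity of finite-volume random-cluster probabilities in `p`

Topic `Literature/Probability/LatticeModels`. For a finite graph `G`, `q > 0`, a wired set `B` and
any event `A`, the probability `p ↦ φ^B_{G,p,q}(A)` is a continuous function of `p ∈ [0, 1]`: it is
the quotient `∑_{ω ∈ A} p^{|ω|}(1-p)^{|E∖ω|}q^{k(ω)} / Z^B_{G,p,q}` of two polynomials in `p` with a
denominator that is positive on `[0, 1]` (Grimmett 2006, §4.5, proof of Thm. (4.58): "since
`Z_{Λ_k}` is a continuous function of `p` and `q` …"; the finite-volume probabilities are rational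
functions of `p`). This is the elementary input for the upper semicontinuity (hence right
continuity) of decreasing limits of such probabilities, e.g. of `θ¹(p, q)`.

* `continuous_rcWeight_left`, `continuous_rcPartitionFunction_left`;
* `continuousOn_rcMeasure_real` — `ContinuousOn (p ↦ φ^B_{G,p,q}(A)) [0, 1]`.

Everything is proved; no named facts.

## References

* G. Grimmett, *The Random-Cluster Model*, Springer 2006, §1.2 eq. (1.2) and proof of Thm. (4.58)
  (continuity of `Z_Λ` in `p`). [Grimmett2006]
-/

noncomputable section

open MeasureTheory Finset SimpleGraph Topology

namespace Literature.Probability.LatticeModels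

variable {V : Type*} [Fintype V] [DecidableEq V] (G : SimpleGraph V) [DecidableRel G.Adj]

/-- The weight `p ↦ p^{|ω|}(1-p)^{|E∖ω|}q^{k(ω)}` is continuous in `p`.
[cite: Grimmett2006, §1.2, eq. (1.2)] -/
theorem continuous_rcWeight_left (q : ℝ) (B : Set V) (ω : Finset (Sym2 V)) :
    Continuous fun p : ℝ => rcWeight G p q B ω := by
  unfold rcWeight
  fun_prop

/-- The partition function is continuous in `p`. [cite: Grimmett2006, proof of Thm. (4.58) (Z_Λ is continuous in p)] -/
theorem continuous_rcPartitionFunction_left (q : ℝ) (B : Set V) :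
    Continuous fun p : ℝ => rcPartitionFunction G p q B := by
  unfold rcPartitionFunction
  exact continuous_finsetSum _ fun ω _ => continuous_rcWeight_left G q B ω

/-- **Finite-volume random-cluster probabilities are continuous in `p ∈ [0, 1]`** (`q > 0`): the
map `p ↦ φ^B_{G,p,q}(A)` is continuous on `[0, 1]` for every event `A`.
[cite: Grimmett2006, §1.2 eq. (1.2) and proof of Thm. (4.58) (continuity in p)] -/
theorem continuousOn_rcMeasure_real {q : ℝ} (hq : 0 < q) (B : Set V)
    (A : Set (Percolation.BondConfig V)) :
    ContinuousOn (fun p : ℝ => (rcMeasure G p q B).real A) (Set.Icc 0 1) := by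
  classical
  -- on `[0,1]` the probability is the explicit quotient of continuous functions
  set f : ℝ → ℝ := fun p =>
    (∑ ω ∈ G.edgeFinset.powerset, if (↑ω : Percolation.BondConfig V) ∈ A then rcWeight G p q B ω else 0) /
      rcPartitionFunction G p q B with hf
  have hcont : ContinuousOn f (Set.Icc 0 1) := by
    refine ContinuousOn.div ?_ (continuous_rcPartitionFunction_left G q B).continuousOn ?_
    · refine Continuous.continuousOn (continuous_finsetSum _ fun ω _ => ?_)
      split_ifs
      · exact continuous_rcWeight_left G q B ω
      · exact continuous_const
    · intro p hp
      exact (rcPartitionFunction_pos G hp hq B).ne'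
  refine hcont.congr fun p hp => ?_
  rw [hf]
  dsimp only
  rw [rcMeasure_real_apply G hp hq B A, Finset.sum_div]
  exact Finset.sum_congr rfl fun ω _ => by split_ifs <;> simp

/-- Continuity within `[0, 1]` at a point of `[0, 1]`, the form used for one-sided limits.
[cite: Grimmett2006, proof of Thm. (4.58) (continuity in p)] -/
theorem continuousWithinAt_rcMeasure_real {q : ℝ} (hq : 0 < q) (B : Set V)
    (A : Set (Percolation.BondConfig V)) {p₀ : ℝ} (hp₀ : p₀ ∈ Set.Icc (0 : ℝ) 1) :
    ContinuousWithinAt (fun p : ℝ => (rcMeasure G p q B).real A) (Set.Icc 0 1) p₀ :=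
  continuousOn_rcMeasure_real G hq B A p₀ hp₀

end Literature.Probability.LatticeModels

end
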